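import Literature.Barriers.CriticalPhenomena.WeaklySAWPerturbativeBetaA1
import HarnessLib

/-!
# BBS 2015, §6.1/§7.3: the cut-off `j_Ω(m²)` of the 4d weakly SAW coefficients moves by at most a
# constant when the mass is changed by a bounded factor

Source: Bauerschmidt–Brydges–Slade, CMP 337 (2015) [BBS2015], §6.1: "when `m² > 0`, `β_j` decays
exponentially after the mass scale `j_m` … the mass scale `j_Ω` defined in [BBS-rg-flow, (1.7)]
satisfies `|j_m - j_Ω| ≤ O(1)` uniformly as `m² ↓ 0`" ([BBS-rg-pt] Proposition 4.2.2, display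
(jmjOmega)); and §7.3.1, proof of Lemma 7.3.1(ii): "`|j_{m̂} - j_m| ≤ 1 + |log_{L²}m̂² - log_{L²}m²| …
< 2`". Combining the two: for masses `m², m̂²` in `(0, δ]` with `|m² - m̂²| ≤ θm̂²` (`θ ≤ 1 - L⁻²`),
the cut-offs satisfy `|j_Ω(m²) - j_Ω(m̂²)| ≤ 2M + 1`. This is the input of the cut-off shift
(`CutoffQuadHyp.shift` of `WeaklySAWQuadraticFlowCutoffShift.lean`) for the frozen-weight patches of
§7.3 (Steps 2–3 of the proof of Proposition 7.1.1: "`χ̃_j = χ_j(m̃²)`").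

* `floorMassScale_sub_le_one` — the floor mass scales (`sL^{2a} ≤ 1 < sL^{2(a+1)}`) of two such
  masses differ by at most one;
* **`jOmega_betaPT_sub_le`** — `∃ δ > 0, D ∈ ℕ`: for `θ ∈ [0, 1 - L⁻²]`, `m², m̂² ∈ (0, δ]`,
  `|m² - m̂²| ≤ θm̂²`: `j_Ω(β(m²)) ≤ j_Ω(β(m̂²)) + D` and `j_Ω(β(m̂²)) ≤ j_Ω(β(m²)) + D`.
-/

noncomputable section

open Set

namespace Literature.Barriers.CriticalPhenomena

namespace CTWSAW

/-- **The floor mass scales of two comparable masses differ by at most one**: if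
`sL^{2a} ≤ 1 < sL^{2(a+1)}`, `s'L^{2b} ≤ 1 < s'L^{2(b+1)}`, `|s - s'| ≤ θs'` with `0 ≤ θ ≤ 1 - L⁻²`
(`L > 1`), then `a ≤ b + 1` and `b ≤ a + 1`. [cite: BauerschmidtBrydgesSlade2015LogCorr, §7.3.1, Lemma 7.3.1(ii) (proof: "|j_{m̂} - j_m| ≤ 1")] -/
theorem floorMassScale_sub_le_one {L : ℝ} (hL : 1 < L) {θ : ℝ} (hθ0 : 0 ≤ θ) (hθ : θ ≤ 1 - (L ^ 2)⁻¹)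
    {s s' : ℝ} (hs' : 0 < s') (hclose : |s - s'| ≤ θ * s') {a b : ℕ}
    (ha : s * L ^ (2 * a) ≤ 1) (ha' : 1 < s * L ^ (2 * (a + 1)))
    (hb : s' * L ^ (2 * b) ≤ 1) (hb' : 1 < s' * L ^ (2 * (b + 1))) : a ≤ b + 1 ∧ b ≤ a + 1 := by
  have hL0 : 0 < L := by linarith
  have hL2 : 1 < L ^ 2 := by nlinarith
  have hL20 : 0 < L ^ 2 := by positivity
  have hθ1 : θ < 1 := by
    have : 0 < (L ^ 2)⁻¹ := by positivity
    linarith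
  have hlow : (1 - θ) * s' ≤ s := by linarith [(abs_le.1 hclose).1]
  have hup : s ≤ (1 + θ) * s' := by linarith [(abs_le.1 hclose).2]
  have hkey : 1 ≤ (1 - θ) * L ^ 2 := by
    have : (L ^ 2)⁻¹ * L ^ 2 = 1 := inv_mul_cancel₀ hL20.ne'
    nlinarith
  have hkey' : 1 + θ ≤ L ^ 2 := by nlinarith
  have hmono : ∀ {p q : ℕ}, p ≤ q → L ^ (2 * p) ≤ L ^ (2 * q) := fun hpq =>
    pow_le_pow_right₀ hL.le (by omega)
  constructor
  · by_contra hcon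
    push Not at hcon
    -- `a ≥ b + 2`: `sL^{2a} ≥ (1-θ)s'L^{2(b+2)} = (1-θ)L²·s'L^{2(b+1)} > 1`
    have h1 : s * L ^ (2 * a) ≥ (1 - θ) * s' * L ^ (2 * (b + 2)) :=
      mul_le_mul hlow (hmono (by omega)) (by positivity) (by nlinarith [hs'.le])
    have h2 : (1 - θ) * s' * L ^ (2 * (b + 2)) = ((1 - θ) * L ^ 2) * (s' * L ^ (2 * (b + 1))) := by ring
    have h3 : 1 < ((1 - θ) * L ^ 2) * (s' * L ^ (2 * (b + 1))) :=
      lt_of_lt_of_le hb' (le_mul_of_one_le_left (by positivity) hkey)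
    linarith
  · by_contra hcon
    push Not at hcon
    -- `b ≥ a + 2`: `s'L^{2b} ≥ s'L^{2(a+2)} ≥ sL^{2(a+2)}/(1+θ) = (L²/(1+θ))·sL^{2(a+1)} > 1`
    have h1 : s' * L ^ (2 * b) ≥ s' * L ^ (2 * (a + 2)) := mul_le_mul_of_nonneg_left (hmono (by omega)) hs'.le
    have h2 : (1 + θ) * (s' * L ^ (2 * (a + 2))) ≥ s * L ^ (2 * (a + 2)) := by
      rw [← mul_assoc]; exact mul_le_mul_of_nonneg_right hup (by positivity)
    have h3 : s * L ^ (2 * (a + 2)) = L ^ 2 * (s * L ^ (2 * (a + 1))) := by ring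
    have h4 : L ^ 2 * 1 < L ^ 2 * (s * L ^ (2 * (a + 1))) := mul_lt_mul_of_pos_left ha' hL20
    nlinarith

/-- **The cut-off `j_Ω(m²)` is stable under bounded relative changes of the mass**: there are
`δ ∈ (0,1]` and `D ∈ ℕ` such that for `θ ∈ [0, 1 - L⁻²]` and `m², m̂² ∈ (0,δ]` with `|m² - m̂²| ≤ θm̂²`,
`j_Ω(β(m²)) ≤ j_Ω(β(m̂²)) + D` and `j_Ω(β(m̂²)) ≤ j_Ω(β(m²)) + D` (`β = betaPT 4 L ·`, `L ≥ 2`, `Ω > 1`).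
[cite: BauerschmidtBrydgesSlade2015LogCorr, §6.1 ("|j_m - j_Ω| is bounded uniformly as m² ↓ 0") and §7.3.1, Lemma 7.3.1(ii) (proof: |j_{m̂} - j_m| ≤ 1)] -/
theorem jOmega_betaPT_sub_le {L : ℝ} (hL : 2 ≤ L) {Ω : ℝ} (hΩ : 1 < Ω) :
    ∃ δ : ℝ, 0 < δ ∧ δ ≤ 1 ∧ ∃ D : ℕ, ∀ θ : ℝ, 0 ≤ θ → θ ≤ 1 - (L ^ 2)⁻¹ →
      ∀ s s' : ℝ, 0 < s → s ≤ δ → 0 < s' → s' ≤ δ → |s - s'| ≤ θ * s' →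
        jOmega (betaPT 4 L s) Ω ≤ jOmega (betaPT 4 L s') Ω + D ∧
          jOmega (betaPT 4 L s') Ω ≤ jOmega (betaPT 4 L s) Ω + D := by
  have hL1 : (1 : ℝ) < L := by linarith
  obtain ⟨δ, hδ, hδ1, M, hM⟩ := jOmega_betaPT_massScale hL hΩ
  refine ⟨δ, hδ, hδ1, 2 * M + 1, fun θ hθ0 hθ s s' hs hsδ hs' hs'δ hclose => ?_⟩
  obtain ⟨a, ha, ha'⟩ := exists_massScale hL1 hs (hsδ.trans hδ1)
  obtain ⟨b, hb, hb'⟩ := exists_massScale hL1 hs' (hs'δ.trans hδ1)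
  obtain ⟨hΩa, haΩ⟩ := hM s hs hsδ a ha ha'
  obtain ⟨hΩb, hbΩ⟩ := hM s' hs' hs'δ b hb hb'
  obtain ⟨hab, hba⟩ := floorMassScale_sub_le_one hL1 hθ0 hθ hs' hclose ha ha' hb hb'
  -- `ℕ∞` bookkeeping: `j_Ω(s) ≤ a + M ≤ b + 1 + M ≤ j_Ω(s') + M + 1 + M`
  have e1 : ((a + M : ℕ) : ℕ∞) ≤ ((b + 1 + M : ℕ) : ℕ∞) := by exact_mod_cast (by omega : a + M ≤ b + 1 + M)
  have e2 : ((b + M : ℕ) : ℕ∞) ≤ ((a + 1 + M : ℕ) : ℕ∞) := by exact_mod_cast (by omega : b + M ≤ a + 1 + M)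
  have f1 : ((b + 1 + M : ℕ) : ℕ∞) ≤ jOmega (betaPT 4 L s') Ω + (2 * M + 1 : ℕ) := by
    have : ((b + 1 + M : ℕ) : ℕ∞) = (b : ℕ∞) + ((1 + M : ℕ) : ℕ∞) := by push_cast; ring
    rw [this]
    calc (b : ℕ∞) + ((1 + M : ℕ) : ℕ∞) ≤ (jOmega (betaPT 4 L s') Ω + M) + ((1 + M : ℕ) : ℕ∞) :=
          add_le_add hbΩ le_rfl
      _ = jOmega (betaPT 4 L s') Ω + (2 * M + 1 : ℕ) := by
          rw [add_assoc]; congr 1; push_cast; ring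
  have f2 : ((a + 1 + M : ℕ) : ℕ∞) ≤ jOmega (betaPT 4 L s) Ω + (2 * M + 1 : ℕ) := by
    have : ((a + 1 + M : ℕ) : ℕ∞) = (a : ℕ∞) + ((1 + M : ℕ) : ℕ∞) := by push_cast; ring
    rw [this]
    calc (a : ℕ∞) + ((1 + M : ℕ) : ℕ∞) ≤ (jOmega (betaPT 4 L s) Ω + M) + ((1 + M : ℕ) : ℕ∞) :=
          add_le_add haΩ le_rfl
      _ = jOmega (betaPT 4 L s) Ω + (2 * M + 1 : ℕ) := by
          rw [add_assoc]; congr 1; push_cast; ring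
  exact ⟨hΩa.trans (e1.trans f1), hΩb.trans (e2.trans f2)⟩

end CTWSAW

end Literature.Barriers.CriticalPhenomena
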